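import Literature.Topology.FourManifolds.HomotopySpheresSignatureProofs
import Literature.Topology.FourManifolds.BCSStablyParallelizable
import Literature.Topology.FourManifolds.CorkDecompositionSplittingProof
import Literature.Topology.FourManifolds.NeckCapping
import Literature.Topology.FourManifolds.SmoothEmbeddingComp
import HarnessLib

/-!
# Kervaire–Milnor's Lemma 3.4 for null-cobordisms with disconnected total space

Topic `Literature/Topology/FourManifolds`; the last step of the proof of the named fact
`Literature.Topology.FourManifolds.boundsParallelizable_of_collapseNullHomotopic`
(`PontryaginThomCollapse.lean`; Kervaire–Milnor, *Groups of homotopy spheres I*, Ann. of Math.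
77 (1963), proof of Lemma 4.2, p. 510: *"It follows from Lemmas 3.3 and 3.4 that `W` is
parallelizable"*, Lemma 3.4 (p. 509): *"A connected manifold with non-vacuous boundary is
s-parallelizable if and only if it is parallelizable"*).  The transversality preimage `W` of
Lemma 4.2 need not be connected, and Lemma 3.4 applies only to the components meeting the
boundary; the closed components are discarded.  The tree proves Lemma 3.4 for a null-cobordism
with connected total space (`NullCobordism.isParallelizable_of_isStablyParallelizable`,
`HomotopySpheresSignatureProofs.lean`); this file removes the connectedness:

* `NullCobordism.exists_isParallelizable_of_isStablyParallelizable_succ`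
  — if `M = ∂W` (dimension of `M` at least `1`) with `W` compact s-parallelisable, then `M = ∂W'`
  with `W'` compact parallelisable: `W'` is the union of the components of `W` meeting `∂W`
  (an open and closed submanifold), each of which is a connected null-cobordism of the
  corresponding open and closed piece of `M`, parallelised by the tree's Lemma 3.4; the frames
  are glued along the (open) components.
* `Literature.Topology.FourManifolds.NullCobordism.isParallelizable_of_isStablyParallelizable_zero`
  — in dimension `1` (`M` of dimension `0`) no hypothesis is needed: a stable frame
  `(v₁, a₁), (v₂, a₂)` of the line bundle `TW ⊕ ℝ` gives the nowhere vanishing field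
  `a₂ v₁ - a₁ v₂` of `TW` (the determinant line of a stably trivial line bundle is trivial).

Everything here is proved; no definitions, no named facts.

## References

* M. Kervaire, J. Milnor, *Groups of homotopy spheres I*, Ann. of Math. (2) 77 (1963),
  Lemma 3.4 (p. 509) and the proof of Lemma 4.2 (p. 510). doi:10.2307/1970128
  [KervaireMilnorAnnals1963]
-/

open scoped Manifold ContDiff Topology
open Set Function Module Bundle TopologicalSpace

noncomputable section

namespace Literature.Topology.FourManifolds

namespace NullCobordism

/-! ### Dimension one: stably trivial line bundles are trivial -/

section DimOne

variable {M : Type} [TopologicalSpace M] [ChartedSpace (EuclideanSpace ℝ (Fin 0)) M]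

/-- **A stably parallelisable `1`-manifold with boundary is parallelisable** (the case
`dim W = 1` of Kervaire–Milnor's Lemma 3.4, where no connectedness or boundary hypothesis is
needed): if `(v₁, a₁), (v₂, a₂)` frame `TW ⊕ ℝ` then `a₂ v₁ - a₁ v₂` is a nowhere vanishing
continuous field of the line bundle `TW` — at a zero, `a₂ s₁ - a₁ s₂` would be a non-trivial
relation, or `v₁, v₂` two independent vectors of a line.
[cite: KervaireMilnorAnnals1963, Lemma 3.4 (p. 509)] -/
theorem isParallelizable_of_isStablyParallelizable_zero (c : NullCobordism 0 M)
    (h : IsStablyParallelizable (𝓡∂ (0 + 1)) c.W) : IsParallelizable (𝓡∂ (0 + 1)) c.W := by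
  obtain ⟨s, hs, hs', hli⟩ := h
  have hrk : finrank ℝ (EuclideanSpace ℝ (Fin (0 + 1))) = 1 := finrank_euclideanSpace_fin
  set j₀ : Fin (finrank ℝ (EuclideanSpace ℝ (Fin (0 + 1))) + 1) := ⟨0, by omega⟩ with hj₀
  set j₁ : Fin (finrank ℝ (EuclideanSpace ℝ (Fin (0 + 1))) + 1) := ⟨1, by omega⟩ with hj₁
  have hj : j₀ ≠ j₁ := by rw [hj₀, hj₁]; simp [Fin.ext_iff]
  -- the field `t = a₂ v₁ - a₁ v₂`
  set t : c.W → EuclideanSpace ℝ (Fin (0 + 1)) :=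
    fun p ↦ (s j₁ p).2 • (s j₀ p).1 + (-(s j₀ p).2) • (s j₁ p).1 with ht
  have htc : Continuous fun p ↦ (TotalSpace.mk' (EuclideanSpace ℝ (Fin (0 + 1))) (id p) (t p) :
      TangentBundle (𝓡∂ (0 + 1)) c.W) :=
    continuous_add_along (continuous_smul_along (hs' j₁) (hs j₀))
      (continuous_smul_along (hs' j₀).neg (hs j₁))
  have ht0 : ∀ p, t p ≠ 0 := by
    intro p h0
    have hinj : Injective ![j₀, j₁] := by
      intro a b hab
      fin_cases a <;> fin_cases b <;> simp_all
    have hli2 : LinearIndependent ℝ ((fun i ↦ s i p) ∘ ![j₀, j₁]) := (hli p).comp _ hinj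
    by_cases hz : (s j₀ p).2 = 0 ∧ (s j₁ p).2 = 0
    · -- two independent vectors `(v₁, 0), (v₂, 0)`: `v₁, v₂` independent in a line
      have hli3 : LinearIndependent ℝ ![(s j₀ p).1, (s j₁ p).1] := by
        have hcomp : (LinearMap.inl ℝ (EuclideanSpace ℝ (Fin (0 + 1))) ℝ) ∘
            ![(s j₀ p).1, (s j₁ p).1] = (fun i ↦ s i p) ∘ ![j₀, j₁] := by
          funext a
          fin_cases a
          · exact Prod.ext rfl hz.1.symm
          · exact Prod.ext rfl hz.2.symm
        refine LinearIndependent.of_comp (LinearMap.inl ℝ _ ℝ) ?_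
        rw [hcomp]; exact hli2
      have := hli3.fintype_card_le_finrank
      rw [Fintype.card_fin, hrk] at this
      omega
    · -- the relation `a₂ s₁ - a₁ s₂ = 0`
      have hrel : (s j₁ p).2 • s j₀ p + (-(s j₀ p).2) • s j₁ p = 0 := by
        refine Prod.ext ?_ ?_
        · simpa [ht] using h0
        · simp only [Prod.snd_add, Prod.smul_snd, smul_eq_mul, Prod.snd_zero]; ring
      have h2 := Fintype.linearIndependent_iff.1 hli2 ![(s j₁ p).2, -(s j₀ p).2]
        (by simpa [Fin.sum_univ_two] using hrel)
      have h20 := h2 0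
      have h21 := h2 1
      simp only [Matrix.cons_val_zero, Matrix.cons_val_one, neg_eq_zero] at h20 h21
      exact hz ⟨h21, h20⟩
  haveI : Subsingleton (Fin (finrank ℝ (EuclideanSpace ℝ (Fin (0 + 1))))) := by
    rw [hrk]; infer_instance
  refine ⟨fun _ ↦ t, fun _ ↦ htc, fun p ↦ ?_⟩
  rw [Fintype.linearIndependent_iff]
  intro g hg i
  have hsum : (∑ i, g i) • t p = 0 := by rwa [Finset.sum_smul]
  rcases smul_eq_zero.1 hsum with h | h
  · have : ∑ i, g i = g i := Fintype.sum_subsingleton _ i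
    rw [← this]; exact h
  · exact absurd h (ht0 p)

end DimOne

/-! ### Restricting a null-cobordism to an open and closed piece of the total space -/

section Restrict

variable {n : ℕ} {M : Type} [TopologicalSpace M] [ChartedSpace (EuclideanSpace ℝ (Fin n)) M]
  [IsManifold (𝓡 n) ∞ M]

/-- **Restriction of a smooth embedding to an open submanifold of its source** is a smooth
embedding (precompose with the inclusion, a globally defined partial diffeomorphism; the tree's
`Manifold.IsSmoothEmbedding.comp_openPartialHomeomorph`). [folklore] -/
theorem isSmoothEmbedding_comp_subtype_val {E' H' : Type*} [NormedAddCommGroup E']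
    [NormedSpace ℝ E'] [TopologicalSpace H'] {J : ModelWithCorners ℝ E' H'}
    {N : Type*} [TopologicalSpace N] [ChartedSpace H' N] [IsManifold J ∞ N]
    {f : M → N} (hf : Manifold.IsSmoothEmbedding (𝓡 n) J ∞ f) (U : Opens M) [Nonempty U] :
    Manifold.IsSmoothEmbedding (𝓡 n) J ∞ (f ∘ (Subtype.val : U → M)) := by
  set Φ := U.openPartialHomeomorphSubtypeCoe ‹Nonempty U› with hΦ
  have hcoe : (Φ : U → M) = Subtype.val := U.openPartialHomeomorphSubtypeCoe_coe _
  have hsrc : Φ.source = univ := U.openPartialHomeomorphSubtypeCoe_source _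
  have h1 : ContMDiffOn (𝓡 n) (𝓡 n) ∞ Φ Φ.source := by
    rw [hcoe]; exact contMDiff_subtype_val.contMDiffOn
  have h2 : ContMDiffOn (𝓡 n) (𝓡 n) ∞ Φ.symm Φ.target := by
    intro x hx
    rw [← ContMDiffWithinAt.subtypeVal_comp_iff U]
    refine (contMDiffWithinAt_id).congr (fun y hy ↦ ?_) ?_
    · show ((Φ.symm y : U) : M) = y
      rw [← hcoe]; exact Φ.right_inv hy
    · show ((Φ.symm x : U) : M) = x
      rw [← hcoe]; exact Φ.right_inv hx
  rw [← hcoe]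
  exact hf.comp_openPartialHomeomorph Φ hsrc h1 h2

end Restrict

/-! ### Lemma 3.4 without connectedness -/

section Components

variable {n : ℕ} {M : Type} [TopologicalSpace M] [ChartedSpace (EuclideanSpace ℝ (Fin (n + 1))) M]
  [IsManifold (𝓡 (n + 1)) ∞ M] [CompactSpace M]

/-- **Kervaire–Milnor's Lemma 3.4 for a null-cobordism with possibly disconnected total space**
(proof of Lemma 4.2, p. 510: *"It follows from Lemmas 3.3 and 3.4 that `W` is parallelizable"*,
the closed components of the transversality preimage being discarded).  If `M = ∂W` with `W`
compact and s-parallelisable (`dim M ≥ 1`), then `M = ∂W'` for a compact **parallelisable** `W'`,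
namely the union of the components of `W` which meet `∂W`: each is a connected null-cobordism of
an open and closed piece of `M`, parallelised by Lemma 3.4
(`NullCobordism.isParallelizable_of_isStablyParallelizable`), and the framings glue along the
open components.
[cite: KervaireMilnorAnnals1963, Lemma 3.4 (p. 509) and proof of Lemma 4.2 (p. 510)] -/
theorem exists_isParallelizable_of_isStablyParallelizable_succ (c : NullCobordism (n + 1) M)
    (h : IsStablyParallelizable (𝓡∂ (n + 1 + 1)) c.W) :
    ∃ c' : NullCobordism (n + 1) M, IsParallelizable (𝓡∂ (n + 1 + 1)) c'.W := by
  classical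
  haveI : LocallyConnectedSpace c.W :=
    ChartedSpace.locallyConnectedSpace (EuclideanHalfSpace (n + 1 + 1)) c.W
  -- the union `good` of the components meeting `∂W = range incl`
  set good : Set c.W := {w | (connectedComponent w ∩ range c.incl).Nonempty} with hgood
  have hgood_comp : ∀ {w w' : c.W}, w' ∈ connectedComponent w → (w ∈ good ↔ w' ∈ good) :=
    fun hw' ↦ by rw [hgood, mem_setOf_eq, mem_setOf_eq, connectedComponent_eq hw']
  have hgood_open : IsOpen good := by
    rw [isOpen_iff_mem_nhds]
    intro w hw
    filter_upwards [isOpen_connectedComponent.mem_nhds (mem_connectedComponent (x := w))]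
      with w' hw' using (hgood_comp hw').1 hw
  have hgood_closed : IsClosed good := by
    rw [← isOpen_compl_iff, isOpen_iff_mem_nhds]
    intro w hw
    filter_upwards [isOpen_connectedComponent.mem_nhds (mem_connectedComponent (x := w))]
      with w' hw' using fun h' ↦ hw ((hgood_comp hw').2 h')
  set U : Opens c.W := ⟨good, hgood_open⟩ with hU
  haveI : CompactSpace U := isCompact_iff_compactSpace.1 hgood_closed.isCompact
  have hmemU : ∀ x : M, c.incl x ∈ U := fun x ↦
    ⟨c.incl x, mem_connectedComponent, mem_range_self x⟩
  have hrangeU : range (fun x ↦ (⟨c.incl x, hmemU x⟩ : U)) = (𝓡∂ (n + 1 + 1)).boundary U := by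
    ext a
    rw [mem_boundary_opens_iff, ← c.range_incl]
    constructor
    · rintro ⟨x, rfl⟩; exact ⟨x, rfl⟩
    · rintro ⟨x, hx⟩; exact ⟨x, Subtype.ext hx⟩
  let c' : NullCobordism (n + 1) M :=
    { W := U
      incl := fun x ↦ ⟨c.incl x, hmemU x⟩
      isSmoothEmbedding_incl := c.isSmoothEmbedding_incl.codRestrict_opens U hmemU
      range_incl := hrangeU }
  refine ⟨c', ?_⟩
  -- a frame of `TW` over each component meeting the boundary (Lemma 3.4 on the component)
  have hcomp : ∀ C : {C : Set c.W // ∃ w₀ ∈ good, C = connectedComponent w₀},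
      ∃ s : Fin (finrank ℝ (EuclideanSpace ℝ (Fin (n + 1 + 1)))) → c.W →
        EuclideanSpace ℝ (Fin (n + 1 + 1)),
        (∀ i, ContinuousOn (fun v ↦ (TotalSpace.mk' (EuclideanSpace ℝ (Fin (n + 1 + 1))) v (s i v) :
          TangentBundle (𝓡∂ (n + 1 + 1)) c.W))
          C.1) ∧ ∀ v ∈ C.1, LinearIndependent ℝ fun i ↦ s i v := by
    rintro ⟨_, w₀, hw₀, rfl⟩
    set C : Opens c.W := ⟨connectedComponent w₀, isOpen_connectedComponent⟩ with hC
    haveI : CompactSpace C := isCompact_iff_compactSpace.1 isClosed_connectedComponent.isCompact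
    haveI : ConnectedSpace C := isConnected_iff_connectedSpace.1 isConnected_connectedComponent
    -- the open and closed piece of `M` over `C`
    set MC : Opens M := ⟨c.incl ⁻¹' (C : Set c.W), C.isOpen.preimage c.continuous_incl⟩ with hMC
    haveI : CompactSpace MC := isCompact_iff_compactSpace.1
      ((isClosed_connectedComponent.preimage c.continuous_incl).isCompact)
    haveI hMCne : Nonempty MC := by
      obtain ⟨b, hbC, ⟨x, rfl⟩⟩ := hw₀
      exact ⟨⟨x, hbC⟩⟩
    have hinclC : ∀ x : MC, (c.incl ∘ (Subtype.val : MC → M)) x ∈ C := fun x ↦ x.2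
    have hemb : Manifold.IsSmoothEmbedding (𝓡 (n + 1)) (𝓡∂ (n + 1 + 1)) ∞
        (fun x : MC ↦ (⟨(c.incl ∘ (Subtype.val : MC → M)) x, hinclC x⟩ : C)) :=
      (isSmoothEmbedding_comp_subtype_val c.isSmoothEmbedding_incl MC).codRestrict_opens C hinclC
    have hrangeC : range (fun x : MC ↦ (⟨(c.incl ∘ (Subtype.val : MC → M)) x, hinclC x⟩ : C)) =
        (𝓡∂ (n + 1 + 1)).boundary C := by
      ext a
      rw [mem_boundary_opens_iff, ← c.range_incl]
      constructor
      · rintro ⟨x, rfl⟩; exact ⟨x.1, rfl⟩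
      · rintro ⟨x, hx⟩
        exact ⟨⟨x, show c.incl x ∈ (C : Set c.W) by rw [hx]; exact a.2⟩, Subtype.ext hx⟩
    let cC : NullCobordism (n + 1) MC :=
      { W := C
        incl := fun x ↦ ⟨(c.incl ∘ (Subtype.val : MC → M)) x, hinclC x⟩
        isSmoothEmbedding_incl := hemb
        range_incl := hrangeC }
    have hCstab : IsStablyParallelizable (𝓡∂ (n + 1 + 1)) cC.W := by
      have h2 : HasStableTangentFramingAlong (𝓡∂ (n + 1 + 1)) c.W
          (Subtype.val ∘ (id : C → C)) := h.comp ⟨Subtype.val, continuous_subtype_val⟩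
      exact HasStableTangentFramingAlong.of_comp_subtype_val C continuous_id h2
    obtain ⟨σ, hσc, hσli⟩ := cC.isParallelizable_of_isStablyParallelizable hCstab
    refine ⟨fun i v ↦ if hv : v ∈ (C : Set c.W) then σ i ⟨v, hv⟩ else 0, fun i ↦ ?_,
      fun v hv ↦ ?_⟩
    · -- continuity on `C`, transferred from `T C` to `T W`
      have h1 : ContinuousOn (fun v : C ↦ (TotalSpace.mk' (EuclideanSpace ℝ (Fin (n + 1 + 1)))
          ((id v : C) : c.W) (σ i v) : TangentBundle (𝓡∂ (n + 1 + 1)) c.W)) univ :=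
        (continuousOn_totalSpaceMk_opens_iff C continuousOn_id).1 (hσc i).continuousOn
      rw [continuousOn_iff_continuous_restrict]
      refine (continuousOn_univ.1 h1).congr fun v ↦ ?_
      show (TotalSpace.mk' (EuclideanSpace ℝ (Fin (n + 1 + 1))) (v : c.W) (σ i v) :
          TangentBundle (𝓡∂ (n + 1 + 1)) c.W) =
        (TotalSpace.mk' (EuclideanSpace ℝ (Fin (n + 1 + 1))) (v : c.W)
          (if hv : (v : c.W) ∈ (C : Set c.W) then σ i ⟨v, hv⟩ else 0) :
          TangentBundle (𝓡∂ (n + 1 + 1)) c.W)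
      rw [dif_pos (show (v : c.W) ∈ (C : Set c.W) from v.2)]
    · have heq : (fun i ↦ (if hv' : v ∈ (C : Set c.W) then σ i ⟨v, hv'⟩ else 0)) =
          fun i ↦ σ i ⟨v, hv⟩ := funext fun i ↦ dif_pos hv
      show LinearIndependent ℝ fun i ↦ (if hv' : v ∈ (C : Set c.W) then σ i ⟨v, hv'⟩ else 0)
      rw [heq]
      exact hσli ⟨v, hv⟩
  choose s hs hsli using hcomp
  -- glue the frames along the open components
  set idx : U → {C : Set c.W // ∃ w₀ ∈ good, C = connectedComponent w₀} :=
    fun a ↦ ⟨connectedComponent (a : c.W), a, a.2, rfl⟩ with hidx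
  have hidx_eq : ∀ {a a' : U}, (a' : c.W) ∈ connectedComponent (a : c.W) → idx a' = idx a :=
    fun h' ↦ Subtype.ext (connectedComponent_eq h').symm
  show IsParallelizable (𝓡∂ (n + 1 + 1)) U
  refine ⟨fun i a ↦ s (idx a) i a, fun i ↦ ?_, fun a ↦ hsli (idx a) a mem_connectedComponent⟩
  -- continuity into `T U`, checked into `T W` (open submanifold) and locally on the component
  have key : ContinuousOn (fun a : U ↦
      (TotalSpace.mk' (EuclideanSpace ℝ (Fin (n + 1 + 1))) ((id a : U) : c.W) (s (idx a) i a) :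
      TangentBundle (𝓡∂ (n + 1 + 1)) c.W)) univ := by
    intro a₀ _
    have hopen : IsOpen {a : U | (a : c.W) ∈ connectedComponent (a₀ : c.W)} :=
      isOpen_connectedComponent.preimage continuous_subtype_val
    have hloc : ContinuousOn (fun a : U ↦
        (TotalSpace.mk' (EuclideanSpace ℝ (Fin (n + 1 + 1))) (a : c.W) (s (idx a₀) i a) :
        TangentBundle (𝓡∂ (n + 1 + 1)) c.W)) {a : U | (a : c.W) ∈ connectedComponent (a₀ : c.W)} :=
      (hs (idx a₀) i).comp continuous_subtype_val.continuousOn fun a ha ↦ ha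
    have hev : (fun a : U ↦
        (TotalSpace.mk' (EuclideanSpace ℝ (Fin (n + 1 + 1))) ((id a : U) : c.W) (s (idx a) i a) :
        TangentBundle (𝓡∂ (n + 1 + 1)) c.W)) =ᶠ[𝓝 a₀]
        fun a : U ↦
          (TotalSpace.mk' (EuclideanSpace ℝ (Fin (n + 1 + 1))) (a : c.W) (s (idx a₀) i a) :
          TangentBundle (𝓡∂ (n + 1 + 1)) c.W) := by
      filter_upwards [hopen.mem_nhds (mem_connectedComponent (x := (a₀ : c.W)))] with a ha
      show (TotalSpace.mk' (EuclideanSpace ℝ (Fin (n + 1 + 1))) (a : c.W) (s (idx a) i a) :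
          TangentBundle (𝓡∂ (n + 1 + 1)) c.W) = _
      rw [hidx_eq ha]
    exact ((hloc.continuousAt (hopen.mem_nhds mem_connectedComponent)).congr hev.symm
      ).continuousWithinAt  -- ContinuousAt.congr : ContinuousAt f x → f =ᶠ g → ContinuousAt g x
  have := (continuousOn_totalSpaceMk_opens_iff U continuousOn_id).2 key
  exact continuousOn_univ.1 this

end Components

end NullCobordism

end Literature.Topology.FourManifolds

end
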